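import Summits.BirchSwinnertonDyer.Rank1Residual.AdditivePotMult.QuadraticBaseChangeOddTamagawaSemistable
import Literature.NumberTheory.EllipticCurves.BSDQuadraticDescentTorsionOddPartProofs
import HarnessLib

/-!
# Milne's rank-zero quadratic BSD-quotient identity on S₁ is its `2`-primary part
# (row T-MIL-ODD, FILE C-3e; seat n1011-p01 GEN 6)

HONEST FRAMING (cell `b2b-bsdres`, run/shared/lean/b2b/bsd-rank1-residual/, verbatim in every
file): the goal of the cell is to DELETE the COMBINATION-SHAPED residual classes of the
Birch–Swinnerton-Dyer formula for ALL analytic-rank `≤ 1` elliptic curves over `ℚ` — "full BSD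
formula for every rank `≤ 1` curve in class `C`" assembled STRICTLY from published theorems — so
that the rank-`≤ 1` remainder becomes exactly the CONSTRUCTION-SHAPED classes, which are TYPED
(missing-input `Prop`s), NOT attempted. This is not "finishing BSD". Sub-classes X3♯(M) / X4(M)
(additive, potentially multiplicative prime; base-change-and-descend): a RESEARCH ROUTE; they stay
CONSTRUCTION-SHAPED; nothing is booked by this file; no mark / label moved. THEOREMS ONLY: no
definition, no named fact, no `sorry`.

## What (row T-MIL-ODD, `cells/n1011/skel/T-MIL-ODD.md` §0)

The tree (`Literature/…/BSDQuadraticDescentTorsionOddPartProofs.lean`, Part II) reduced the named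
fact `WeierstrassCurve.bsdRHS_baseChange_quadratic` (Milne, Invent. Math. 17 (1972) §1 Thm. 1 in
rank `0` over an imaginary quadratic `K` — the Burungale–Flach descent input) to the identity of
rationals (R1) `|N(C'.u)|·#Ш(W')·∏c(W')·#W(ℚ)²·#W_d(ℚ)² = n_W·|C_d.u|·#Ш(W)·#Ш(W_d)·∏c(W)·∏c(W_d)·#W'(K)²`,
and (R1) to the conjunction of its `2`-adic valuation and, for every odd `p`, the odd Tamagawa
identity (`card_identity_iff_padicValRat`). FILE C-3d proved the latter on the population S₁
(`padicValRat_norm_mul_tamagawaProduct_eq_of_semistable`). Hence, for every datum in S₁ with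
`d_K` odd squarefree:

* `card_identity_of_padicValRat_two_of_semistable` — **(R1) holds as soon as its two sides have the
  same `2`-adic valuation** (any quadratic `K` with odd squarefree `d_K`, `W'(K)` and `Ш(W'/K)` finite);
* `bsdQuotient_baseChange_quadratic_of_padicValRat_two_of_semistable` — for IMAGINARY such `K`:
  **Milne's identity `bsdPeriod(W')·#Ш(W')·∏c(W')/#W'(K)² = RHS(W)·RHS(W_d)` follows from the
  `2`-adic identity alone** (tree `bsdQuotient_baseChange_quadratic_eq_iff`).

So on S₁ the rank-zero Milne / A65-shaped input is EXACTLY its `2`-primary part — in Milne's proof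
the Cassels–Tate / local-`2`-index content (*ADT* I.7.3), which this row does not touch. HONEST
LIMITS: conditional on the displayed `2`-adic hypothesis `htwo` (a hypothesis, never a fact);
population S₁ × {`d_K` odd squarefree} only; discharges no named fact (the fact quantifies over all
data); closes no class; moves no mark.
-/

noncomputable section

open scoped Classical NumberField

open WeierstrassCurve NumberField IsDedekindDomain Rat.HeightOneSpectrum
  Literature.NumberTheory.EllipticCurves

namespace Summit.BirchSwinnertonDyer.Rank1Residual.AdditivePotMult

section RankZero

variable (W : WeierstrassCurve ℚ) [W.IsElliptic] [W.IsGloballyMinimal]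
  (K : Type) [Field K] [NumberField K] (Wd : WeierstrassCurve ℚ) [Wd.IsElliptic] [Wd.IsGloballyMinimal]
  (W' : WeierstrassCurve K) [W'.IsElliptic] [W'.IsGloballyMinimal]

/-- **(R1) on S₁ from its `2`-adic part.** For `W/ℚ` globally minimal elliptic, `K` quadratic with
`d_K` odd squarefree, globally minimal models `W_d = C_d • W^{(d_K)}`, `W' = C' • W_K` with `W'(K)`
and `Ш(W'/K)` finite, and the population hypothesis `hS` of FILE C-3d: if the two sides of Milne's
identity of rationals (R1) have the same `2`-adic valuation, then (R1) holds — the odd valuations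
agree by `padicValRat_norm_mul_tamagawaProduct_eq_of_semistable` and the tree's
`card_identity_iff_padicValRat`.
[cite: Milne1972ArithmeticAV, §1 Thm. 1 and §2 (through DokchitserDokchitserAnnals2010, §2.1, proof of Thm. 8)] -/
theorem card_identity_of_padicValRat_two_of_semistable (h2 : Module.finrank ℚ K = 2)
    (hdodd : Odd (NumberField.discr K)) (hdsq : Squarefree (NumberField.discr K))
    {Cd : VariableChange ℚ} (hWd : Cd • W.quadraticTwist (NumberField.discr K : ℚ) = Wd)
    {C' : VariableChange K} (hW' : C' • W.baseChange K = W') [Finite W'.toAffine.Point]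
    (hsha : W'.ShaFinite)
    (hS : ∀ v : HeightOneSpectrum (𝓞 ℚ), W.HasGoodReductionAt v ∨
      (W.HasMultiplicativeReductionAt v ∧ ((primesEquiv v : ℕ) ≠ 2 ∨ NumberField.discr K % 8 = 1)) ∨
      (((primesEquiv v : ℕ) : ℤ) ∣ NumberField.discr K ∧ Wd.HasMultiplicativeReductionAt v))
    (htwo : padicValRat 2 (|Algebra.norm ℚ (C'.u : K)| * W'.shaOrder * W'.tamagawaProduct *
          (Nat.card W.toAffine.Point) ^ 2 * (Nat.card Wd.toAffine.Point) ^ 2 : ℚ) =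
        padicValRat 2 ((W.baseChange ℝ).numRealComponents * |(Cd.u : ℚ)| * W.shaOrder *
          Wd.shaOrder * W.tamagawaProduct * Wd.tamagawaProduct *
          (Nat.card W'.toAffine.Point) ^ 2 : ℚ)) :
    (|Algebra.norm ℚ (C'.u : K)| * W'.shaOrder * W'.tamagawaProduct *
          (Nat.card W.toAffine.Point) ^ 2 * (Nat.card Wd.toAffine.Point) ^ 2 : ℚ) =
        (W.baseChange ℝ).numRealComponents * |(Cd.u : ℚ)| * W.shaOrder * Wd.shaOrder *
          W.tamagawaProduct * Wd.tamagawaProduct * (Nat.card W'.toAffine.Point) ^ 2 := by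
  refine (W.card_identity_iff_padicValRat K h2 hWd hW' hsha).mpr ⟨htwo, fun p hp hp2 => ?_⟩
  haveI := Fact.mk hp
  exact padicValRat_norm_mul_tamagawaProduct_eq_of_semistable W K Wd W' h2 hdodd hdsq hWd hW' hS p
    hp2

/-- **Milne's rank-zero quadratic BSD-quotient identity on S₁ from its `2`-adic part** (imaginary
`K` with `d_K` odd squarefree — e.g. `K = ℚ(√−p)`, `p ≡ 3 mod 4`): under the hypotheses of
`card_identity_of_padicValRat_two_of_semistable`,
`bsdPeriod(W') · #Ш(W') · ∏_w c_w(W') / #W'(K)² = RHS(W) · RHS(W_d)` (tree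
`bsdQuotient_baseChange_quadratic_eq_iff`). The rank-zero, totally complex shape of the A65 /
`bsdRHS_baseChange_quadratic` input, with everything but the `2`-primary part PROVED on S₁.
[cite: Milne1972ArithmeticAV, §1 Thm. 1 and §2 (through DokchitserDokchitserAnnals2010, §2.1, proof of Thm. 8)] -/
theorem bsdQuotient_baseChange_quadratic_of_padicValRat_two_of_semistable [IsTotallyComplex K]
    (h2 : Module.finrank ℚ K = 2)
    (hdodd : Odd (NumberField.discr K)) (hdsq : Squarefree (NumberField.discr K))
    {Cd : VariableChange ℚ} (hWd : Cd • W.quadraticTwist (NumberField.discr K : ℚ) = Wd)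
    {C' : VariableChange K} (hW' : C' • W.baseChange K = W') [Finite W'.toAffine.Point]
    (hsha : W'.ShaFinite)
    (hS : ∀ v : HeightOneSpectrum (𝓞 ℚ), W.HasGoodReductionAt v ∨
      (W.HasMultiplicativeReductionAt v ∧ ((primesEquiv v : ℕ) ≠ 2 ∨ NumberField.discr K % 8 = 1)) ∨
      (((primesEquiv v : ℕ) : ℤ) ∣ NumberField.discr K ∧ Wd.HasMultiplicativeReductionAt v))
    (htwo : padicValRat 2 (|Algebra.norm ℚ (C'.u : K)| * W'.shaOrder * W'.tamagawaProduct *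
          (Nat.card W.toAffine.Point) ^ 2 * (Nat.card Wd.toAffine.Point) ^ 2 : ℚ) =
        padicValRat 2 ((W.baseChange ℝ).numRealComponents * |(Cd.u : ℚ)| * W.shaOrder *
          Wd.shaOrder * W.tamagawaProduct * Wd.tamagawaProduct *
          (Nat.card W'.toAffine.Point) ^ 2 : ℚ)) :
    W'.bsdPeriod * (W'.shaOrder : ℝ) * (W'.tamagawaProduct : ℝ) /
        (Nat.card W'.toAffine.Point : ℝ) ^ 2 = W.bsdRHS * Wd.bsdRHS :=
  (bsdQuotient_baseChange_quadratic_eq_iff W K h2 hWd hW').mpr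
    (card_identity_of_padicValRat_two_of_semistable W K Wd W' h2 hdodd hdsq hWd hW' hsha hS htwo)

end RankZero

end Summit.BirchSwinnertonDyer.Rank1Residual.AdditivePotMult

end
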